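import Literature.RepresentationTheory.Ichino2022.ExplicitDefLineModel

/-!
# Ichino (2022) Lemma 7.10 HOLDS in the explicit Fock model `ℂ[z₁, z₂, z₃]` of `(U(1), U(3))` — the theorems

For the definite signatures `(p,q;r,s) = (1,0;3,0)` and `(0,1;3,0)` the [Ich22] §7.5 Lemma 7.10 correspondence of
`K × K′ = U(1) × U(3)`-types in the joint harmonics is a THEOREM of the explicit polynomial model of
`Literature.RepresentationTheory.Ichino2022.ExplicitDefLineModel`:

* `explicitPosLine S hr`, `explicitNegLine S hr : FockHarmonics S` — `μ ⊠ μ′` corresponds iff some joint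
  highest-weight vector has the weights `(μ; μ′)` MINUS the printed vacuum shifts `(r−s)/2 + m₀/2` (on `U(W)`) and
  `(p−q)/2 + n₀/2` (on `U(V)`), the §4.1 exponents `m₀, n₀` of `χ_V, χ_W` entering only through the shifts;
* **`lemma_7_10_explicitPosLine`** (`S.p = 1, S.q = 0, S.r = 3, S.s = 0`) and **`lemma_7_10_explicitNegLine`**
  (`S.p = 0, S.q = 1, S.r = 3, S.s = 0`): `(explicit…Line S hr).Lemma_7_10`.

At `(1,0;3,0)` the lemma's parameters are `p⁺ ≤ 1`, `p⁻ = q⁺ = q⁻ = 0`: `μ = (a₁) + shift`, `μ′ = (a₁,0,0) + shift`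
(`a₁ > 0`) or the vacuum — matching `z₁^{a₁}`; at `(0,1;3,0)` they are `q⁻ ≤ 1`: `μ = (;d₁) + shift`,
`μ′ = (0,0,d₁) + shift` (`d₁ < 0`) — matching `z₃^{−d₁}` in the conjugate model.

## References
* A. Ichino, Adv. Math. 398 (2022) 108188, §4.1, §7.5 Lemma 7.10. [Ichino2022ThetaReal]
-/

noncomputable section

namespace Literature.RepresentationTheory.Ichino2022

namespace ExplicitDefLine

open MvPolynomial Finsupp FockHarmonics HarmonicParam

/-! ## §3 The two `FockHarmonics` dictionaries and Ichino's Lemma 7.10 as THEOREMS -/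

section Dictionary

/-- Parameters of Lemma 7.10 with `p⁻ = q⁺ = 0`, `p⁺ = pp ≤ 1`, `q⁻ = qm ≤ 1`. [cite: Ichino2022ThetaReal, §7.5 Lemma 7.10] -/
def defParam (S : SplittingDatum) (pp qm : ℕ) (hpp : pp ≤ 1) (hqm : qm ≤ 1) (hp : pp ≤ S.p) (hq : qm ≤ S.q)
    (hr : pp + qm ≤ S.r) (a : Fin pp → ℤ) (d : Fin qm → ℤ) (a_pos : ∀ i, 0 < a i) (d_neg : ∀ j, d j < 0) :
    HarmonicParam S where
  pp := pp
  pm := 0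
  qp := 0
  qm := qm
  a := a
  b := Fin.elim0
  c := Fin.elim0
  d := d
  a_anti := fun i j _ => by
    have : i = j := Fin.ext (by have := i.isLt; have := j.isLt; omega)
    rw [this]
  b_anti := fun i => i.elim0
  c_anti := fun i => i.elim0
  d_anti := fun i j _ => by
    have : i = j := Fin.ext (by have := i.isLt; have := j.isLt; omega)
    rw [this]
  a_pos := a_pos
  b_neg := fun i => i.elim0
  c_pos := fun i => i.elim0
  d_neg := d_neg
  hp := by omega
  hq := by omega
  hr := hr
  hs := by omega

/-- **The [Ich22] dictionary of the positive-line model against `U(3)`** (`r = 3`): `μ ⊠ μ′` corresponds iff a joint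
highest-weight vector of the explicit model has the polynomial weights `(μ; μ′)` minus the printed vacuum shifts.
[cite: Ichino2022ThetaReal, §4.1 and §7.5 Lemma 7.10] -/
def explicitPosLine (S : SplittingDatum) (hr : S.r = 3) : FockHarmonics S where
  corresponds μ μ' := ∃ (f : DefModel) (k t₀ t₁ t₂ : ℤ), IsHWPos f k t₀ t₁ t₂ ∧
    (∀ i, μ.1 i = (k : ℚ) + ((S.r : ℚ) - S.s) / 2 + (S.m₀ : ℚ) / 2) ∧
    μ'.1 ⟨0, by omega⟩ = (t₀ : ℚ) + ((S.p : ℚ) - S.q) / 2 + (S.n₀ : ℚ) / 2 ∧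
    μ'.1 ⟨1, by omega⟩ = (t₁ : ℚ) + ((S.p : ℚ) - S.q) / 2 + (S.n₀ : ℚ) / 2 ∧
    μ'.1 ⟨2, by omega⟩ = (t₂ : ℚ) + ((S.p : ℚ) - S.q) / 2 + (S.n₀ : ℚ) / 2

/-- **The [Ich22] dictionary of the negative-line (conjugate) model against `U(3)`.**
[cite: Ichino2022ThetaReal, §4.1 and §7.5 Lemma 7.10] -/
def explicitNegLine (S : SplittingDatum) (hr : S.r = 3) : FockHarmonics S where
  corresponds μ μ' := ∃ (f : DefModel) (k t₀ t₁ t₂ : ℤ), IsHWNeg f k t₀ t₁ t₂ ∧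
    (∀ j, μ.2 j = (k : ℚ) + ((S.s : ℚ) - S.r) / 2 + (S.m₀ : ℚ) / 2) ∧
    μ'.1 ⟨0, by omega⟩ = (t₀ : ℚ) + ((S.p : ℚ) - S.q) / 2 + (S.n₀ : ℚ) / 2 ∧
    μ'.1 ⟨1, by omega⟩ = (t₁ : ℚ) + ((S.p : ℚ) - S.q) / 2 + (S.n₀ : ℚ) / 2 ∧
    μ'.1 ⟨2, by omega⟩ = (t₂ : ℚ) + ((S.p : ℚ) - S.q) / 2 + (S.n₀ : ℚ) / 2

/-- An index of `Fin S.r`, `S.r = 3`, is `0`, `1` or `2`. [folklore] -/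
theorem fin_r_cases {S : SplittingDatum} (hr : S.r = 3) (i : Fin S.r) :
    i = ⟨0, by omega⟩ ∨ i = ⟨1, by omega⟩ ∨ i = ⟨2, by omega⟩ := by
  have hi : i.val = 0 ∨ i.val = 1 ∨ i.val = 2 := by have := i.isLt; omega
  rcases hi with hi | hi | hi
  · exact Or.inl (Fin.ext hi)
  · exact Or.inr (Or.inl (Fin.ext hi))
  · exact Or.inr (Or.inr (Fin.ext hi))

/-- **Ichino's Lemma 7.10 HOLDS in the explicit positive-line model `ℂ[z₁,z₂,z₃]` of `(U(1), U(3))`**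
(`(p,q;r,s) = (1,0;3,0)`), for every choice of the exponents `(m₀, n₀)` carried by `S`.
[cite: Ichino2022ThetaReal, §7.5 Lemma 7.10] -/
theorem lemma_7_10_explicitPosLine (S : SplittingDatum) (hp : S.p = 1) (hq : S.q = 0) (hr : S.r = 3)
    (hs : S.s = 0) : (explicitPosLine S hr).Lemma_7_10 := by
  intro μ μ'
  show (∃ (f : DefModel) (k t₀ t₁ t₂ : ℤ), IsHWPos f k t₀ t₁ t₂ ∧ _) ↔ _
  constructor
  · rintro ⟨f, k, t₀, t₁, t₂, hf, hμ, h0, h1, h2⟩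
    obtain ⟨a, c, -, -, rfl, rfl, rfl, rfl⟩ := (isHWPos_iff f k t₀ t₁ t₂).mp hf
    by_cases ha : a = 0
    · subst ha
      refine ⟨defParam S 0 0 (by omega) (by omega) (by omega) (by omega) (by omega) Fin.elim0 Fin.elim0
        (fun i => i.elim0) (fun j => j.elim0), ?_, ?_⟩
      · ext i
        · rw [hμ i, mu_fst_apply, pad_mid _ _ _ _ (by show 0 ≤ i.val; omega) (by show i.val < S.p - 0; omega)]
          push_cast; ring
        · exact (Fin.cast hq i).elim0
      · ext i
        · rw [mu'_fst_apply, pad_mid _ _ _ _ (by show 0 ≤ i.val; omega) (by show i.val < S.r - 0; omega)]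
          rcases fin_r_cases hr i with rfl | rfl | rfl
          · rw [h0]; push_cast; ring
          · rw [h1]; push_cast; ring
          · rw [h2]; push_cast; ring
        · exact (Fin.cast hs i).elim0
    · have ha1 : 0 < (a : ℤ) := by omega
      refine ⟨defParam S 1 0 (by omega) (by omega) (by omega) (by omega) (by omega) (fun _ => a) Fin.elim0
        (fun _ => ha1) (fun j => j.elim0), ?_, ?_⟩
      · ext i
        · rw [hμ i, mu_fst_apply, pad_head _ _ _ _ (by show i.val < 1; omega)]
          simp only [defParam]
        · exact (Fin.cast hq i).elim0
      · ext i
        · rw [mu'_fst_apply]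
          rcases fin_r_cases hr i with rfl | rfl | rfl
          · rw [h0, pad_head _ _ _ _ (by show 0 < 1; omega)]
            simp only [defParam]
          · rw [h1, pad_mid _ _ _ _ (by show 1 ≤ 1; omega) (by show 1 < S.r - 0; omega)]
            push_cast; ring
          · rw [h2, pad_mid _ _ _ _ (by show 1 ≤ 2; omega) (by show 2 < S.r - 0; omega)]
            push_cast; ring
        · exact (Fin.cast hs i).elim0
  · rintro ⟨P, hμ, hμ'⟩
    have hPq : P.qp + P.qm ≤ S.q := P.hq
    have hPs : P.pm + P.qp ≤ S.s := P.hs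
    have hPp : P.pp + P.pm ≤ S.p := P.hp
    have hqm : P.qm = 0 := by omega
    have hqp : P.qp = 0 := by omega
    have hpm : P.pm = 0 := by omega
    rcases Nat.lt_or_ge 0 P.pp with hpp | hpp
    · -- `p⁺ = 1`: `z₁^{a₁}`
      have ha := P.a_pos ⟨0, hpp⟩
      have hcast : (((P.a ⟨0, hpp⟩).toNat : ℤ) : ℚ) = (P.a ⟨0, hpp⟩ : ℚ) := by
        exact_mod_cast Int.toNat_of_nonneg ha.le
      refine ⟨_, _, _, _, _, (isHWPos_iff _ _ _ _ _).mpr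
        ⟨(P.a ⟨0, hpp⟩).toNat, 1, one_ne_zero, rfl, rfl, rfl, rfl, rfl⟩, ?_, ?_, ?_, ?_⟩
      · intro i
        rw [hμ, mu_fst_apply, pad_head _ _ _ _ (by omega)]
        have : P.a ⟨i.val, by omega⟩ = P.a ⟨0, hpp⟩ := by congr 1; exact Fin.ext (by have := i.isLt; omega)
        rw [this, hcast]
      · rw [hμ', mu'_fst_apply, pad_head _ _ _ _ (by simp; omega), hcast]
      · rw [hμ', mu'_fst_apply, pad_mid _ _ _ _ (by simp; omega) (by simp; omega)]
        push_cast; ring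
      · rw [hμ', mu'_fst_apply, pad_mid _ _ _ _ (by simp; omega) (by simp; omega)]
        push_cast; ring
    · -- the vacuum
      have hpp0 : P.pp = 0 := by omega
      refine ⟨_, _, _, _, _, (isHWPos_iff _ _ _ _ _).mpr ⟨0, 1, one_ne_zero, rfl, rfl, rfl, rfl, rfl⟩,
        ?_, ?_, ?_, ?_⟩
      · intro i
        rw [hμ, mu_fst_apply, pad_mid _ _ _ _ (by omega) (by have := i.isLt; omega)]
        push_cast; ring
      · rw [hμ', mu'_fst_apply, pad_mid _ _ _ _ (by simp; omega) (by simp; omega)]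
        push_cast; ring
      · rw [hμ', mu'_fst_apply, pad_mid _ _ _ _ (by simp; omega) (by simp; omega)]
        push_cast; ring
      · rw [hμ', mu'_fst_apply, pad_mid _ _ _ _ (by simp; omega) (by simp; omega)]
        push_cast; ring

/-- **Ichino's Lemma 7.10 HOLDS in the explicit negative-line (conjugate) model of `(U(1), U(3))`**
(`(p,q;r,s) = (0,1;3,0)`). [cite: Ichino2022ThetaReal, §7.5 Lemma 7.10] -/
theorem lemma_7_10_explicitNegLine (S : SplittingDatum) (hp : S.p = 0) (hq : S.q = 1) (hr : S.r = 3)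
    (hs : S.s = 0) : (explicitNegLine S hr).Lemma_7_10 := by
  intro μ μ'
  show (∃ (f : DefModel) (k t₀ t₁ t₂ : ℤ), IsHWNeg f k t₀ t₁ t₂ ∧ _) ↔ _
  constructor
  · rintro ⟨f, k, t₀, t₁, t₂, hf, hμ, h0, h1, h2⟩
    obtain ⟨d, c, -, -, rfl, rfl, rfl, rfl⟩ := (isHWNeg_iff f k t₀ t₁ t₂).mp hf
    by_cases hd : d = 0
    · subst hd
      refine ⟨defParam S 0 0 (by omega) (by omega) (by omega) (by omega) (by omega) Fin.elim0 Fin.elim0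
        (fun i => i.elim0) (fun j => j.elim0), ?_, ?_⟩
      · ext i
        · exact (Fin.cast hp i).elim0
        · rw [hμ i, mu_snd_apply, pad_mid _ _ _ _ (by show 0 ≤ i.val; omega) (by show i.val < S.q - 0; omega)]
          push_cast; ring
      · ext i
        · rw [mu'_fst_apply, pad_mid _ _ _ _ (by show 0 ≤ i.val; omega) (by show i.val < S.r - 0; omega)]
          rcases fin_r_cases hr i with rfl | rfl | rfl
          · rw [h0]; push_cast; ring
          · rw [h1]; push_cast; ring
          · rw [h2]; push_cast; ring
        · exact (Fin.cast hs i).elim0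
    · have hd1 : (-(d : ℤ)) < 0 := by omega
      refine ⟨defParam S 0 1 (by omega) (by omega) (by omega) (by omega) (by omega) Fin.elim0
        (fun _ => -(d : ℤ)) (fun i => i.elim0) (fun _ => hd1), ?_, ?_⟩
      · ext i
        · exact (Fin.cast hp i).elim0
        · rw [hμ i, mu_snd_apply, pad_tail _ _ _ _ (by show 0 ≤ i.val; omega) (by show S.q - 1 ≤ i.val; omega)]
          simp only [defParam]
      · ext i
        · rw [mu'_fst_apply]
          rcases fin_r_cases hr i with rfl | rfl | rfl
          · rw [h0, pad_mid _ _ _ _ (by show 0 ≤ 0; omega) (by show 0 < S.r - 1; omega)]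
            push_cast; ring
          · rw [h1, pad_mid _ _ _ _ (by show 0 ≤ 1; omega) (by show 1 < S.r - 1; omega)]
            push_cast; ring
          · rw [h2, pad_tail _ _ _ _ (by show 0 ≤ 2; omega) (by show S.r - 1 ≤ 2; omega)]
            simp only [defParam]
        · exact (Fin.cast hs i).elim0
  · rintro ⟨P, hμ, hμ'⟩
    have hPq : P.qp + P.qm ≤ S.q := P.hq
    have hPs : P.pm + P.qp ≤ S.s := P.hs
    have hPp : P.pp + P.pm ≤ S.p := P.hp
    have hPr : P.pp + P.qm ≤ S.r := P.hr
    have hpp : P.pp = 0 := by omega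
    have hpm : P.pm = 0 := by omega
    have hqp : P.qp = 0 := by omega
    rcases Nat.lt_or_ge 0 P.qm with hqm | hqm
    · -- `q⁻ = 1`: `z₃^{−d₁}`
      have hd := P.d_neg ⟨0, hqm⟩
      have hcast : (((-(P.d ⟨0, hqm⟩)).toNat : ℕ) : ℚ) = -((P.d ⟨0, hqm⟩ : ℤ) : ℚ) := by
        exact_mod_cast Int.toNat_of_nonneg (by omega : (0:ℤ) ≤ -(P.d ⟨0, hqm⟩))
      refine ⟨_, _, _, _, _, (isHWNeg_iff _ _ _ _ _).mpr
        ⟨(-(P.d ⟨0, hqm⟩)).toNat, 1, one_ne_zero, rfl, rfl, rfl, rfl, rfl⟩, ?_, ?_, ?_, ?_⟩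
      · intro j
        rw [hμ, mu_snd_apply, pad_tail _ _ _ _ (by omega) (by have := j.isLt; omega)]
        have : P.d ⟨j.val - (S.q - P.qm), by have := j.isLt; omega⟩ = P.d ⟨0, hqm⟩ := by
          congr 1; exact Fin.ext (by have := j.isLt; simp; omega)
        rw [this]; push_cast; rw [hcast]; ring
      · rw [hμ', mu'_fst_apply, pad_mid _ _ _ _ (by omega) (by simp; omega)]
        push_cast; ring
      · rw [hμ', mu'_fst_apply, pad_mid _ _ _ _ (by omega) (by simp; omega)]
        push_cast; ring
      · rw [hμ', mu'_fst_apply, pad_tail _ _ _ _ (by omega) (by simp; omega)]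
        have : P.d ⟨2 - (S.r - P.qm), by omega⟩ = P.d ⟨0, hqm⟩ := by
          congr 1; exact Fin.ext (by simp; omega)
        rw [this]; push_cast; rw [hcast]; ring
    · -- the vacuum
      have hqm0 : P.qm = 0 := by omega
      refine ⟨_, _, _, _, _, (isHWNeg_iff _ _ _ _ _).mpr ⟨0, 1, one_ne_zero, rfl, rfl, rfl, rfl, rfl⟩,
        ?_, ?_, ?_, ?_⟩
      · intro j
        rw [hμ, mu_snd_apply, pad_mid _ _ _ _ (by omega) (by have := j.isLt; omega)]
        push_cast; ring
      · rw [hμ', mu'_fst_apply, pad_mid _ _ _ _ (by omega) (by simp; omega)]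
        push_cast; ring
      · rw [hμ', mu'_fst_apply, pad_mid _ _ _ _ (by omega) (by simp; omega)]
        push_cast; ring
      · rw [hμ', mu'_fst_apply, pad_mid _ _ _ _ (by omega) (by simp; omega)]
        push_cast; ring

end Dictionary

end ExplicitDefLine

end Literature.RepresentationTheory.Ichino2022
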